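import Summits.BirchSwinnertonDyer.Rank1Residual.Additive.KobayashiHondaPoints
import Literature.NumberTheory.EllipticCurves.FormalGroupFrobeniusTypeAllPrimesProofs
import HarnessLib

/-!
# Route `ThetaPartnerAtTwo` (TP2), crux K3 `SignedKatoDivisibilityUpToAtTwo` (item stmt-BirchSwinnertonDyer-20308),
# line `colemanrat` v3 — THE LOCAL THEORY AT `p = 2`, file 1: Honda's isomorphism `F_ss ≅ Ê` and Honda points
# at EVERY prime (the tree's odd-`p` files `KobayashiHondaIso` §2 / `KobayashiHondaPoints` with `p ≠ 2` removed)

HONEST FRAMING (cell `bsd-wall`, lead `bsd-wall-tp2-p2x` g2): THEOREMS ONLY — no definition, no named fact, no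
instance, no `sorry`; pure local formal-group theory; nothing about any Selmer group is asserted; closes no item;
BSD is NOT proved by any of this.

## Why this file

The research residue of K3 at `p = 2` is Kobayashi's LOCAL `±` theory (Invent. Math. 152 §8) for a good
supersingular curve with `a₂ = 0` along `ℚ₂(μ_{2^∞})` (Kurihara–Otsuki 2006 p. 557: «we can define ± Selmer groups
as in Kobayashi, and can study them by the same method as for `p > 2`» — asserted, not printed). The tree PROVES
§8.1–8.4 of that theory for ODD `p` (`Rank1Residual/Additive/KobayashiHondaIso`, `…HondaPoints`, `…TowerPoints`,
`…TowerGeneration`), where `p ≠ 2` enters at exactly ONE place: the Honda type `T² + p` of `log_E`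
(`WeierstrassCurve.norm_coeff_hondaShift_formalLog_le_one`, proved with the `char ≠ 2` formal-point dictionary).
Its all-primes twin `WeierstrassCurve.norm_coeff_hondaShift_formalLog_le_one'` (file
`FormalGroupFrobeniusTypeAllPrimesProofs`) is now in the tree, so the local series ports to `p = 2`. This file is
the first port: every statement of `KobayashiHondaIso` §2 and `KobayashiHondaPoints` with the hypothesis `p ≠ 2`
DELETED. To stay definition-free, Honda's integral isomorphism is written as the closed term
`liftInt (hondaPsi p M) h` for an integrality witness `h : ∀ n, ‖[Xⁿ]ψ‖ ≤ 1` (supplied at every prime by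
`norm_coeff_hondaPsi_le_one'`); for odd `p` this term IS the tree's `hondaIso p M hp2 htr` (`liftInt_hondaPsi_eq_hondaIso`,
`rfl`), so nothing is duplicated in content.

## What is proved (`M/ℤ_p` with elliptic generic and special fibre, `a_p(M) = 0`, ANY prime `p`;
## `ψ = hondaPsi p M = exp_E ∘ log_{F_ss}`, `i_h = liftInt ψ h`, `j_h' = liftInt ψ⁻¹ h'`, `Λ = ptLog`)

* §1 `norm_coeff_hondaPsi_le_one'`, `norm_coeff_hondaPsiInv_le_one'`: `ψ, ψ⁻¹ ∈ ℤ_p⟦X⟧` (Honda's Thm. 2 for the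
  type `T² + p`, both logarithms of that type at every `p`); `constantCoeff_liftInt_hondaPsi(_Inv)`,
  `liftInt_hondaPsi_subst_liftInt_hondaPsiInv` (`i ∘ j = X`) and its converse, `formalLog_subst_map_liftInt_hondaPsi`
  (`log_E ∘ i = log_{F_ss}`), `liftInt_hondaPsi_eq_hondaIso` (odd `p`: the tree's `hondaIso`, by `rfl`).
* §2 Honda points over any complete ultrametric `K ⊇ ℚ_p`: `c_h(x) = ptOf (i_h(x)) ∈ E₁(K)` for `‖x‖ < 1`;
  `ptLog_hondaPt'` (`Λ(c_h(x)) = log_{F_ss}(x)`), `exists_eq_hondaPt'` (every `P ∈ E₁(K)` is `c_h(j_{h'}(z P))`),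
  `exists_mem_norm_ptLog_sub_le_one'` (`Λ(E₁(K)) ⊆ K' + 𝒪_K` under the Frobenius hypothesis on `(K, K')`),
  `ptLog_hondaPt'_eq_sum` (closed form at roots of unity).
At `p = 2`, `a₂ = 0`: these are Kobayashi Prop. 8.4 / §8.4 (Lemma 8.9, Prop. 8.11's `Λ_n ⊆ 𝔪_n + k_{n−1}`) for
the Honda type `t² + 2` (Kitajima–Otsuki 2018 §3.1 shape with `k = ℚ₂`, `d = 1`).

References: [Kobayashi2003] §8.1–8.4 (Thm. 8.3, Prop. 8.4, Lemma 8.9, Prop. 8.11); [Honda1970] Thm. 2, Thm. 9;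
[KuriharaOtsuki2006] p. 557; [KitajimaOtsuki2018] §3.1.
-/

set_option autoImplicit false
-- the Theorems namespace of this sub repeats the summit name by design (D-0017 nested layout)
set_option linter.dupNamespace false

noncomputable section

open scoped Classical Topology NNReal
open Filter PowerSeries

namespace Summit.BirchSwinnertonDyer.BirchSwinnertonDyer.Theorems

namespace SignedKatoOffTwo.LocalAllPrimes

open Literature.RingTheory.FormalGroups WeierstrassCurve
open Summit.BirchSwinnertonDyer.Rank1Residual.Additive
open Summit.BirchSwinnertonDyer.Rank1Residual.Additive.HondaFss
open Summit.BirchSwinnertonDyer.Rank1Residual.Additive.BallEval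
open Literature.NumberTheory.GaloisRepresentations.LubinTate (unitBall mem_unitBall_iff)
open Literature.NumberTheory.EllipticCurves Literature.NumberTheory.EllipticCurves.FormalGroupChart

/-! ## §1 Honda's isomorphism at every prime -/

section Honda

variable (p : ℕ) [hp : Fact p.Prime] (M : WeierstrassCurve ℤ_[p])
  [hE : (M.map PadicInt.Coe.ringHom).IsElliptic] [hEt : (M.map PadicInt.toZMod).IsElliptic]

/-- `log_E` is of Honda type `T² + p` when `a_p(M) = 0`, at EVERY prime `p` (the tree's all-primes Honda
congruences `norm_coeff_hondaShift_formalLog_le_one'`). [cite: Kobayashi2003, Prop. 8.4] [cite: Honda1970, Thm. 9 (pp. 240–241)] -/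
theorem norm_coeff_hondaShift_formalLog_le_one_of_tr_eq_zero'
    (htr : Literature.NumberTheory.EllipticCurves.HasseManin.tr (M.map PadicInt.toZMod) = 0) (n : ℕ) :
    ‖coeff n (hondaShift p 0 (M.map (PadicInt.Coe.ringHom (p := p))).formalLog)‖ ≤ 1 := by
  have h := M.norm_coeff_hondaShift_formalLog_le_one' n
  rwa [htr, Int.cast_zero] at h

/-- **`ψ = exp_E ∘ log_{F_ss} ∈ ℤ_p⟦X⟧` at every prime** (Honda: two logarithms of the same type `T² + p`).
[cite: Kobayashi2003, Prop. 8.4] [cite: Honda1970, Thm. 2 (p. 223)] -/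
theorem norm_coeff_hondaPsi_le_one'
    (htr : Literature.NumberTheory.EllipticCurves.HasseManin.tr (M.map PadicInt.toZMod) = 0) (n : ℕ) :
    ‖coeff n (hondaPsi p M)‖ ≤ 1 := by
  refine norm_coeff_le_one_of_subst_eq (p := p) (a := 0) (by simp)
    (norm_coeff_hondaShift_formalLog_le_one_of_tr_eq_zero' p M htr) (norm_coeff_hondaShift_logFss_le_one p)
    ?_ (constantCoeff_hondaPsi p M) (formalLog_subst_hondaPsi p M) n
  rw [(M.map PadicInt.Coe.ringHom).coeff_one_formalLog, norm_one]

/-- **`ψ⁻¹ = exp_{F_ss} ∘ log_E ∈ ℤ_p⟦X⟧` at every prime** (Honda, roles exchanged). [cite: Kobayashi2003, Prop. 8.4]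
[cite: Honda1970, Thm. 2 (p. 223)] -/
theorem norm_coeff_hondaPsiInv_le_one'
    (htr : Literature.NumberTheory.EllipticCurves.HasseManin.tr (M.map PadicInt.toZMod) = 0) (n : ℕ) :
    ‖coeff n (hondaPsiInv p M)‖ ≤ 1 :=
  norm_coeff_le_one_of_subst_eq (p := p) (a := 0) (by simp) (norm_coeff_hondaShift_logFss_le_one p)
    (norm_coeff_hondaShift_formalLog_le_one_of_tr_eq_zero' p M htr) (norm_coeff_one_logFss p)
    (constantCoeff_hondaPsiInv p M) (logFss_subst_hondaPsiInv p M) n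

variable {p M}

/-- For odd `p` the integral lift `liftInt ψ h` IS the tree's `hondaIso p M hp2 htr` (any witness `h`; proof
irrelevance): this file duplicates no object. [cite: Kobayashi2003, Prop. 8.4] -/
theorem liftInt_hondaPsi_eq_hondaIso (hp2 : p ≠ 2)
    (htr : Literature.NumberTheory.EllipticCurves.HasseManin.tr (M.map PadicInt.toZMod) = 0)
    (h : ∀ n, ‖coeff n (hondaPsi p M)‖ ≤ 1) : liftInt (hondaPsi p M) h = hondaIso p M hp2 htr := rfl

omit hE hEt in
/-- `i(0) = 0` for `i = liftInt ψ h`. [folklore] -/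
theorem constantCoeff_liftInt_hondaPsi (h : ∀ n, ‖coeff n (hondaPsi p M)‖ ≤ 1) :
    constantCoeff (liftInt (hondaPsi p M) h) = 0 := by
  have h0 := congrArg (coeff 0) (map_liftInt (hondaPsi p M) h)
  rw [coeff_map, PowerSeries.coeff_zero_eq_constantCoeff, PowerSeries.coeff_zero_eq_constantCoeff,
    constantCoeff_hondaPsi] at h0
  exact Subtype.ext h0

omit hE hEt in
/-- `j(0) = 0` for `j = liftInt ψ⁻¹ h'`. [folklore] -/
theorem constantCoeff_liftInt_hondaPsiInv (h' : ∀ n, ‖coeff n (hondaPsiInv p M)‖ ≤ 1) :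
    constantCoeff (liftInt (hondaPsiInv p M) h') = 0 := by
  have h0 := congrArg (coeff 0) (map_liftInt (hondaPsiInv p M) h')
  rw [coeff_map, PowerSeries.coeff_zero_eq_constantCoeff, PowerSeries.coeff_zero_eq_constantCoeff,
    constantCoeff_hondaPsiInv] at h0
  exact Subtype.ext h0

omit hE hEt in
/-- **`i ∘ j = X`** over `ℤ_p`, every prime. [cite: Kobayashi2003, Prop. 8.4] -/
theorem liftInt_hondaPsi_subst_liftInt_hondaPsiInv (h : ∀ n, ‖coeff n (hondaPsi p M)‖ ≤ 1)
    (h' : ∀ n, ‖coeff n (hondaPsiInv p M)‖ ≤ 1) :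
    (liftInt (hondaPsi p M) h).subst (liftInt (hondaPsiInv p M) h') = X := by
  apply HondaFss.map_injective
  rw [map_subst_apply (HasSubst.of_constantCoeff_zero' (constantCoeff_liftInt_hondaPsiInv h')),
    map_liftInt, map_liftInt, PowerSeries.map_X]
  exact hondaPsi_subst_hondaPsiInv p M

omit hE hEt in
/-- **`j ∘ i = X`** over `ℤ_p`, every prime. [cite: Kobayashi2003, Prop. 8.4] -/
theorem liftInt_hondaPsiInv_subst_liftInt_hondaPsi (h : ∀ n, ‖coeff n (hondaPsi p M)‖ ≤ 1)
    (h' : ∀ n, ‖coeff n (hondaPsiInv p M)‖ ≤ 1) :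
    (liftInt (hondaPsiInv p M) h').subst (liftInt (hondaPsi p M) h) = X := by
  apply HondaFss.map_injective
  rw [map_subst_apply (HasSubst.of_constantCoeff_zero' (constantCoeff_liftInt_hondaPsi h)),
    map_liftInt, map_liftInt, PowerSeries.map_X]
  exact hondaPsiInv_subst_hondaPsi p M

omit hE hEt in
/-- **`log_E ∘ (i ⊗ ℚ_p) = log_{F_ss}`** for `i = liftInt ψ h`, every prime. [cite: Kobayashi2003, Prop. 8.4] -/
theorem formalLog_subst_map_liftInt_hondaPsi (h : ∀ n, ‖coeff n (hondaPsi p M)‖ ≤ 1) :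
    (M.map (PadicInt.Coe.ringHom (p := p))).formalLog.subst ((liftInt (hondaPsi p M) h).map PadicInt.Coe.ringHom) =
      logFss p := by
  rw [map_liftInt]; exact formalLog_subst_hondaPsi p M

end Honda

/-! ## §2 Honda points at every prime -/

section Points

variable (p : ℕ) [hp : Fact p.Prime] (K : Type*) [NontriviallyNormedField K] [NormedAlgebra ℚ_[p] K]
  [IsUltrametricDist K] [CompleteSpace K] (M : WeierstrassCurve ℤ_[p])
  [hE : (M.map PadicInt.Coe.ringHom).IsElliptic]

variable {p K M}
variable [hint : (curveK p K M).IsIntegral (NormedField.valuation (K := K)).integer]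

omit hint in
/-- **`Λ(c(x)) = log_{F_ss}(x)`** for the Honda point `c(x) = ptOf (i(x))`, `i = liftInt ψ h`, `‖x‖ < 1`
(`log_E ∘ i = log_{F_ss}` and `qEval_subst`); every prime. [cite: Kobayashi2003, Lemma 8.9] -/
theorem ptLog_hondaPt' (h : ∀ n, ‖coeff n (hondaPsi p M)‖ ≤ 1) {x : unitBall K} (hx : ‖(x : K)‖ < 1) :
    ptLog p K M (ptOf p K M (ev₁ p K x (hasEval_of_norm_lt_one hx) (liftInt (hondaPsi p M) h))
        (norm_ev₁_lt_one_of_constantCoeff (constantCoeff_liftInt_hondaPsi h) hx)) =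
      qEval p K (logFss p) (x : K) := by
  rw [ptLog, zCoord_ptOf, bLog, ← formalLog_subst_map_liftInt_hondaPsi h]
  exact (qEval_subst (K := K) (norm_coeff_logQ_le (p := p) (M := M)) (constantCoeff_liftInt_hondaPsi h) hx).symm

omit hint hE in
/-- `i(j(t)) = t` at points of the open unit ball (`i ∘ j = X`). [folklore] -/
theorem ev₁_liftInt_hondaPsi_ev₁_liftInt_hondaPsiInv (h : ∀ n, ‖coeff n (hondaPsi p M)‖ ≤ 1)
    (h' : ∀ n, ‖coeff n (hondaPsiInv p M)‖ ≤ 1) {t : unitBall K} (ht : ‖(t : K)‖ < 1) :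
    ev₁ p K (ev₁ p K t (hasEval_of_norm_lt_one ht) (liftInt (hondaPsiInv p M) h'))
        (hasEval_of_norm_lt_one (norm_ev₁_lt_one_of_constantCoeff (constantCoeff_liftInt_hondaPsiInv h') ht))
        (liftInt (hondaPsi p M) h) = t := by
  rw [← ev₁_subst (constantCoeff_liftInt_hondaPsiInv h') (hasEval_of_norm_lt_one ht),
    liftInt_hondaPsi_subst_liftInt_hondaPsiInv h h', ev₁_X]

/-- **Every `P ∈ E₁(K)` is a Honda point**: `P = ptOf (i(x))` with `x = j(z P)`, `‖x‖ ≤ ‖z P‖ < 1`; every prime.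
[cite: Kobayashi2003, §8.4] -/
theorem exists_eq_hondaPt' (h : ∀ n, ‖coeff n (hondaPsi p M)‖ ≤ 1) (h' : ∀ n, ‖coeff n (hondaPsiInv p M)‖ ≤ 1)
    {P : (curveK p K M).toAffine.Point} (hP : P ∈ kernel (NormedField.valuation (K := K)) (curveK p K M)) :
    ∃ (x : unitBall K) (hx : ‖(x : K)‖ < 1),
      P = ptOf p K M (ev₁ p K x (hasEval_of_norm_lt_one hx) (liftInt (hondaPsi p M) h))
        (norm_ev₁_lt_one_of_constantCoeff (constantCoeff_liftInt_hondaPsi h) hx) ∧ ‖(x : K)‖ ≤ ‖P.zCoord‖ := by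
  set x : unitBall K := ev₁ p K (zBall P hP) (hasEval_of_norm_lt_one (norm_zBall_lt_one hP))
    (liftInt (hondaPsiInv p M) h') with hxdef
  have hxle : ‖(x : K)‖ ≤ ‖P.zCoord‖ :=
    norm_ev₁_le _ (norm_zBall_lt_one hP).le (constantCoeff_liftInt_hondaPsiInv h')
  have hx : ‖(x : K)‖ < 1 := hxle.trans_lt (norm_zCoord_lt_one hP)
  refine ⟨x, hx, ?_, hxle⟩
  refine eq_of_zCoord_eq hP (ptOf_mem_kernel _) ?_
  have hxt : ev₁ p K x (hasEval_of_norm_lt_one hx) (liftInt (hondaPsi p M) h) = zBall P hP :=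
    ev₁_liftInt_hondaPsi_ev₁_liftInt_hondaPsiInv h h' (norm_zBall_lt_one hP)
  rw [zCoord_ptOf, hxt]; rfl

omit hint in
/-- **`Λ(c(x))` in closed form at a root of unity** (every prime): if `(1 + x)^{p^{2k}} = 1` for `k ≥ k₀` then
`Λ(ptOf (i(x))) = ∑_{k<k₀} (−1)ᵏ((1+x)^{p^{2k}} − 1)/pᵏ`. [cite: Kobayashi2003, Lemma 8.9] -/
theorem ptLog_hondaPt'_eq_sum (h : ∀ n, ‖coeff n (hondaPsi p M)‖ ≤ 1) {x : unitBall K} (hx : ‖(x : K)‖ < 1)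
    {k₀ : ℕ} (hk : ∀ k, k₀ ≤ k → (1 + (x : K)) ^ p ^ (2 * k) = 1) :
    ptLog p K M (ptOf p K M (ev₁ p K x (hasEval_of_norm_lt_one hx) (liftInt (hondaPsi p M) h))
        (norm_ev₁_lt_one_of_constantCoeff (constantCoeff_liftInt_hondaPsi h) hx)) =
      ∑ k ∈ Finset.range k₀, logFssRow p K (x : K) k := by
  rw [ptLog_hondaPt' _ hx, qEval_logFss_eq_sum_of_pow_eq_one hx hk]

variable [hEt : (M.map PadicInt.toZMod).IsElliptic]

/-- **`Λ(E₁(K)) ⊆ K' + 𝒪_K` at EVERY prime** for a subfield `K'` with the Frobenius property (every `y ∈ 𝒪_K` has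
`yᵖ ∈ (K' ∩ 𝒪_K) + p𝒪_K`), for a good supersingular `a_p = 0` model: `Λ(P) = log_{F_ss}(x)` for the Honda parameter
`x` of `P` (Honda's isomorphism at every prime, §1) and the congruence form of `log_{F_ss}`. At `p = 2` this is
Kobayashi's Prop. 8.11 «`Λ(Ê(𝔪_n)) ⊆ 𝔪_n + k_{n−1}`» input for `ℚ₂(ζ_{2^{n}}) ⊇ ℚ₂(ζ_{2^{n−1}})`.
[cite: Kobayashi2003, Prop. 8.11] -/
theorem exists_mem_norm_ptLog_sub_le_one'
    (htr : Literature.NumberTheory.EllipticCurves.HasseManin.tr (M.map PadicInt.toZMod) = 0) (K' : Subfield K)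
    (hFrob : ∀ y : K, ‖y‖ ≤ 1 → ∃ s ∈ K', ‖s‖ ≤ 1 ∧ ‖y ^ p - s‖ ≤ ‖(p : K)‖)
    {P : (curveK p K M).toAffine.Point} (hP : P ∈ kernel (NormedField.valuation (K := K)) (curveK p K M)) :
    ∃ μ ∈ K', ‖ptLog p K M P - μ‖ ≤ 1 := by
  obtain ⟨x, hx, hPx, -⟩ :=
    exists_eq_hondaPt' (norm_coeff_hondaPsi_le_one' p M htr) (norm_coeff_hondaPsiInv_le_one' p M htr) hP
  rw [hPx, ptLog_hondaPt' _ hx]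
  exact exists_mem_norm_qEval_logFss_sub_le_one K' hFrob hx

end Points

end SignedKatoOffTwo.LocalAllPrimes

end Summit.BirchSwinnertonDyer.BirchSwinnertonDyer.Theorems

end
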